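import Summits.Ventures.LatticeQCDFlow.Exactness.IMHCouplingChiSquareRate
import HarnessLib

/-!
# The recipe in the flow's own figures of merit: `R = ⌈2(σ² + (c − a)ε/3)·log(4/δ)/ε²⌉` pairs, level `M` with `4R(1 + χ²) ≤ δM²` and
# `2(c − a)(1 + χ²) ≤ εM`, burn-in `k` with `M·log(4R/δ) ≤ k·c₁` and `M·log(2(c − a)/ε) ≤ k·c₁` ⇒ `P(|H̄_R − π f| ≥ 2ε) ≤ δ`

HONEST FRAMING: exact (Metropolis-corrected) sampling algorithms for lattice gauge theory;
figures of merit are autocorrelation/cost numbers at stated couplings and volumes; no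
continuum-physics claim.

Venture `LatticeQCDFlow` (cell pub-lqcd), topic `Exactness`; FANOUT row 30 (lean-1, GEN-40).  NEW WORK of the cell (numbers only), sequel
to `Exactness/IMHCouplingChiSquareRate`: the Bernstein bar of the coupled exact-flow estimator in terms of `1 + χ² = ∫ w² dq = 1/ESS` and
`c₁ = E_q[min(1, w)] ≥ ā` is turned into a budget.  General (standard Borel) state space, every proposal law, every positive normalised
weight in `L²(q)` — no bound on `w`.

* §1 bookkeeping in `ℝ`: **`lintegral_min_one_le_one`** (`c₁ ≤ 1`); **`toReal_chiSq_coupling_term`** —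
  `((1 + χ²)/M^j + (1 − c₁/M)^k).toReal = (1 + χ²)/M^j + (1 − c₁.toReal/M)^k` (`M ≥ 1`); **`one_sub_div_pow_le_of_log_le`** —
  `M·log(1/y) ≤ k·u`, `u ≤ 1 ≤ M`, `y > 0` ⇒ `(1 − u/M)^k ≤ y`.
* §2 **`crnLag_replicas_bernstein_budget_chiSq`** — THE RECIPE: production run at `x`, leading run one update ahead, `R` independent coupled
  pairs, window `N`, burn-in `k`, `σ² ≥ Var_{δ_xK^k} f > 0`, `a < c`, accuracy `ε > 0`, risk `δ > 0`, a level `M ≥ max(1, w(x))` with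
  `4R(1 + χ²) ≤ δM²` and `2(c − a)(1 + χ²) ≤ εM`, `2(σ² + (c − a)ε/3)·log(4/δ) ≤ Rε²`, `M·log(4R/δ) ≤ k·c₁`, `M·log(2(c − a)/ε) ≤ k·c₁`
  ⇒ `P(|H̄_R − π f| ≥ 2ε) ≤ δ`.
Reading (gauge files): with the flow's effective sample size `ESS` and an acceptance floor `c₁ ≥ ā`, `R = ⌈2(σ² + (c − a)ε/3)·log(4/δ)/ε²⌉`
coupled pairs, the level `M = max(√(4R/(δ·ESS)), 2(c − a)/(ε·ESS), 1, w(x))` and `k = ⌈M·max(log(4R/δ), log(2(c − a)/ε))/c₁⌉` discarded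
updates certify accuracy `2ε` at confidence `1 − δ` for `π f` ITSELF — for every flow with `ESS > 0`, no weight bound.
NOT CLAIMED: optimality of the constants; `σ²` in terms of `Var_π f` (see `IMHCoupledEstimatorEquilibriumBernsteinUnboundedWeights`).
No `sorry`, no new definitions, nothing cited as a fact.
-/

noncomputable section

namespace Summit.Ventures.LatticeQCDFlow.Exactness

open MeasureTheory ProbabilityTheory Function Finset Filter
open scoped _root_.ENNReal unitInterval Topology
open Summit.Ventures.LatticeQCDFlow.Scoring

variable {Ω : Type*} [MeasurableSpace Ω] {q : Measure Ω} [IsProbabilityMeasure q] {w : Ω → ℝ}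

/-! ## §1 Bookkeeping in `ℝ` -/

/-- `c₁ = E_q[min(1, w)] ≤ 1` (`ℝ≥0∞`). [ours, bookkeeping] -/
theorem lintegral_min_one_le_one : ∫⁻ y, ENNReal.ofReal (min 1 (w y)) ∂q ≤ 1 := by
  calc ∫⁻ y, ENNReal.ofReal (min 1 (w y)) ∂q ≤ ∫⁻ _, 1 ∂q :=
        lintegral_mono fun y => ENNReal.ofReal_le_one.2 (min_le_left _ _)
    _ = 1 := by rw [lintegral_const, measure_univ, mul_one]

omit [MeasurableSpace Ω] in
/-- `((ofReal C)/(ofReal (M^j)) + (1 − c₁/ofReal M)^k).toReal = C/M^j + (1 − c₁.toReal/M)^k` for `C ≥ 0`, `M ≥ 1`, `c₁ ≤ 1`. [ours, bookkeeping] -/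
theorem toReal_chiSq_coupling_term {C M : ℝ} (hC : 0 ≤ C) (hM : 1 ≤ M) {c₁ : ℝ≥0∞} (hc₁ : c₁ ≤ 1) (j k : ℕ) :
    (ENNReal.ofReal C / ENNReal.ofReal (M ^ j) + (1 - c₁ / ENNReal.ofReal M) ^ k).toReal = C / M ^ j + (1 - c₁.toReal / M) ^ k := by
  have hM0 : 0 < M := by linarith
  have hMj : ENNReal.ofReal (M ^ j) ≠ 0 := ne_of_gt (ENNReal.ofReal_pos.2 (by positivity))
  have hdiv : ENNReal.ofReal C / ENNReal.ofReal (M ^ j) ≠ ⊤ := ENNReal.div_ne_top ENNReal.ofReal_ne_top hMj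
  have hr1 : (1 - c₁ / ENNReal.ofReal M) ^ k ≠ ⊤ :=
    ne_top_of_le_ne_top ENNReal.one_ne_top ((pow_le_pow_left' tsub_le_self k).trans_eq (one_pow k))
  have hle : c₁ / ENNReal.ofReal M ≤ 1 := by
    refine (ENNReal.div_le_iff (ne_of_gt (ENNReal.ofReal_pos.2 hM0)) ENNReal.ofReal_ne_top).2 ?_
    rw [one_mul]
    exact hc₁.trans (ENNReal.one_le_ofReal.2 hM)
  rw [ENNReal.toReal_add hdiv hr1, ENNReal.toReal_div, ENNReal.toReal_ofReal hC, ENNReal.toReal_ofReal (by positivity),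
    ENNReal.toReal_pow, ENNReal.toReal_sub_of_le hle ENNReal.one_ne_top, ENNReal.toReal_one, ENNReal.toReal_div,
    ENNReal.toReal_ofReal hM0.le]

omit [MeasurableSpace Ω] in
/-- `M·log(1/y) ≤ k·u` with `u ≤ 1 ≤ M`, `0 < y` ⇒ `(1 − u/M)^k ≤ y` (`1 − u/M ≤ e^{−u/M}`). [ours, bookkeeping] -/
theorem one_sub_div_pow_le_of_log_le {u M y : ℝ} (hu1 : u ≤ 1) (hM : 1 ≤ M) (hy : 0 < y) {k : ℕ}
    (hk : M * Real.log (1 / y) ≤ k * u) :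
    (1 - u / M) ^ k ≤ y := by
  have hM0 : 0 < M := by linarith
  have huM : u / M ≤ 1 := (div_le_one hM0).2 (hu1.trans hM)
  have hk' : Real.log (1 / y) ≤ k * (u / M) := by
    rw [mul_div_assoc', le_div_iff₀ hM0, mul_comm]; linarith [mul_comm M (Real.log (1 / y))]
  calc (1 - u / M) ^ k ≤ Real.exp (-(u / M)) ^ k :=
        pow_le_pow_left₀ (by linarith) (by have := Real.add_one_le_exp (-(u / M)); linarith) k
    _ = Real.exp (-(k * (u / M))) := by rw [← Real.exp_nat_mul]; ring_nf
    _ ≤ Real.exp (-Real.log (1 / y)) := Real.exp_le_exp.2 (neg_le_neg hk')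
    _ = y := by rw [Real.exp_neg, Real.exp_log (by positivity), one_div, inv_inv]

section Replicas

variable {Ω' : Type*} {mΩ' : MeasurableSpace Ω'} {μ : Measure Ω'} [IsProbabilityMeasure μ]
  {Z : ℕ → Ω' → (ℕ → Ω × Ω)}

/-! ## §2 The recipe -/

/-- **THE BERNSTEIN RECIPE IN THE FLOW'S OWN FIGURES OF MERIT.**  Standard Borel `Ω`; `w` a `Fact`-measurable positive normalised weight in
`L²(q)` (`1 + χ² = ∫ w² dq`), `c₁ = E_q[min(1, w)]`; `K̂` a CRN pair kernel; production run at `x`, leading run one update ahead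
(`ν̂_x = K(x, ·)∘(y ↦ (y, x))⁻¹`); `Z_0, Z_1, …` mutually independent pair streams with that law; `a ≤ f ≤ c` measurable, `a < c`;
burn-in `k`, window `N`, `σ² ≥ Var_{δ_xK^k} f` with `σ² > 0`; accuracy `ε > 0`, risk `δ > 0`; `R ≥ 1` pairs with
`2(σ² + (c − a)ε/3)·log(4/δ) ≤ Rε²`; a level `M ≥ max(1, w(x))` with `4R(1 + χ²) ≤ δM²` and `2(c − a)(1 + χ²) ≤ εM`; and
`M·log(4R/δ) ≤ k·c₁`, `M·log(2(c − a)/ε) ≤ k·c₁`.  Then `P(|R⁻¹Σ_{j<R} H_{k,N}(Z_j) − π f| ≥ 2ε) ≤ δ`. [ours] -/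
theorem crnLag_replicas_bernstein_budget_chiSq [StandardBorelSpace Ω] [Nonempty Ω] [MeasurableSingletonClass Ω]
    [MeasurableEq Ω] [Fact (Measurable w)] (hw0 : ∀ y, 0 < w y) (hmem : MemLp w 2 q) (h1 : ∫ y, w y ∂q = 1)
    [IsProbabilityMeasure (q.withDensity fun y => ENNReal.ofReal (w y))]
    (Khat : Kernel (Ω × Ω) (Ω × Ω)) [IsMarkovKernel Khat]
    (hK : ∀ z : Ω × Ω, Khat z = (q.prod (volume : Measure unitInterval)).map (fun p : Ω × unitInterval =>
      ((if (p.2 : ℝ) * w z.1 ≤ w p.1 then p.1 else z.1), (if (p.2 : ℝ) * w z.2 ≤ w p.1 then p.1 else z.2))))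
    (x : Ω) {M : ℝ} (hM : max 1 (w x) ≤ M) (ν : Measure (Ω × Ω)) [IsProbabilityMeasure ν]
    (hν : ν = (indepMH q w x).map fun y : Ω => (y, x)) {f : Ω → ℝ} (hf : Measurable f) {a c : ℝ} (ha : ∀ y, a ≤ f y)
    (hc : ∀ y, f y ≤ c) (hac : a < c) (k N : ℕ) (hZm : ∀ j, Measurable (Z j))
    (hlaw : ∀ j, μ.map (Z j) = Kernel.trajMeasure (X := fun _ : ℕ => Ω × Ω) ν
      (fun n : ℕ => Khat.comap (fun h : (i : ↥(Finset.Iic n)) → Ω × Ω => h ⟨n, Finset.mem_Iic.2 le_rfl⟩)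
        (measurable_pi_apply _)))
    (hind : iIndepFun Z μ) {σ2 : ℝ} (hσ : 0 < σ2)
    (hσk : variance f ((fun m : Measure Ω => m.bind (indepMH q w))^[k] (Measure.dirac x)) ≤ σ2)
    {ε δ : ℝ} (hε : 0 < ε) (hδ : 0 < δ) {R : ℕ} (hR : 1 ≤ R)
    (hRε : 2 * (σ2 + (c - a) * ε / 3) * Real.log (4 / δ) ≤ R * ε ^ 2)
    (hMδ : 4 * R * (1 + ∫ y, (w y - 1) ^ 2 ∂q) ≤ δ * M ^ 2)
    (hMε : 2 * (c - a) * (1 + ∫ y, (w y - 1) ^ 2 ∂q) ≤ ε * M)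
    (hkδ : M * Real.log (4 * R / δ) ≤ k * (∫⁻ y, ENNReal.ofReal (min 1 (w y)) ∂q).toReal)
    (hkε : M * Real.log (2 * (c - a) / ε) ≤ k * (∫⁻ y, ENNReal.ofReal (min 1 (w y)) ∂q).toReal) :
    μ.real {ω | 2 * ε ≤
        |(R : ℝ)⁻¹ * ∑ j ∈ range R, (f ((Z j ω k).2) + ∑ n ∈ range N, (f ((Z j ω (k + n)).1) - f ((Z j ω (k + n)).2))) -
          ∫ y, f y ∂(q.withDensity fun y => ENNReal.ofReal (w y))|} ≤ δ := by
  have hw : Measurable w := Fact.out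
  have hM1 : 1 ≤ M := (le_max_left _ _).trans hM
  have hM0 : 0 < M := by linarith
  have hca : 0 < c - a := sub_pos.2 hac
  have hRpos : (0 : ℝ) < R := Nat.cast_pos.2 (by omega)
  set C : ℝ := 1 + ∫ y, (w y - 1) ^ 2 ∂q with hCdef
  have hC0 : 0 ≤ C := by
    have hI : 0 ≤ ∫ y, (w y - 1) ^ 2 ∂q := integral_nonneg fun y => sq_nonneg (w y - 1)
    linarith
  set c₁ : ℝ≥0∞ := ∫⁻ y, ENNReal.ofReal (min 1 (w y)) ∂q with hc₁
  have hc₁1 : c₁ ≤ 1 := lintegral_min_one_le_one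
  set u : ℝ := c₁.toReal with hu
  have hu1 : u ≤ 1 := by
    have := ENNReal.toReal_mono ENNReal.one_ne_top hc₁1
    rwa [ENNReal.toReal_one] at this
  -- (i) the Bernstein term
  have hexp : 2 * Real.exp (-(R * ε ^ 2) / (2 * (σ2 + (c - a) * ε / 3))) ≤ δ / 2 :=
    two_mul_exp_bernstein_le_of_log_le (by positivity) hδ hRε
  -- (ii) the geometric factor, twice
  have hρδ : (1 - u / M) ^ k ≤ δ / (4 * R) :=
    one_sub_div_pow_le_of_log_le hu1 hM1 (by positivity) (by rwa [one_div, inv_div])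
  have hρε : (1 - u / M) ^ k ≤ ε / (2 * (c - a)) :=
    one_sub_div_pow_le_of_log_le hu1 hM1 (by positivity) (by rwa [one_div, inv_div])
  -- (iii) the coupling term `R·(C/M² + ρ^k) ≤ δ/2`
  have hcoup : R * (ENNReal.ofReal C / ENNReal.ofReal (M ^ 2) + (1 - c₁ / ENNReal.ofReal M) ^ k).toReal ≤ δ / 2 := by
    rw [toReal_chiSq_coupling_term hC0 hM1 hc₁1 2 k]
    have h1' : R * (C / M ^ 2) ≤ δ / 4 := by
      rw [mul_div_assoc', div_le_iff₀ (by positivity)]; linarith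
    have h2' : R * (1 - u / M) ^ k ≤ δ / 4 :=
      calc R * (1 - u / M) ^ k ≤ R * (δ / (4 * R)) := mul_le_mul_of_nonneg_left hρδ hRpos.le
        _ = δ / 4 := by field_simp
    calc R * (C / M ^ 2 + (1 - u / M) ^ k) = R * (C / M ^ 2) + R * (1 - u / M) ^ k := by ring
      _ ≤ δ / 2 := by linarith
  -- (iv) the bias allowance `(c − a)(C/M + ρ^k) ≤ ε`
  have hbias : (c - a) * (ENNReal.ofReal C / ENNReal.ofReal M + (1 - c₁ / ENNReal.ofReal M) ^ k).toReal ≤ ε := by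
    have h1' := toReal_chiSq_coupling_term hC0 hM1 hc₁1 1 k
    simp only [pow_one] at h1'
    rw [h1']
    have h1' : (c - a) * (C / M) ≤ ε / 2 := by
      rw [mul_div_assoc', div_le_iff₀ hM0]; linarith
    have h2' : (c - a) * (1 - u / M) ^ k ≤ ε / 2 :=
      calc (c - a) * (1 - u / M) ^ k ≤ (c - a) * (ε / (2 * (c - a))) := mul_le_mul_of_nonneg_left hρε hca.le
        _ = ε / 2 := by field_simp
    calc (c - a) * (C / M + (1 - u / M) ^ k) = (c - a) * (C / M) + (c - a) * (1 - u / M) ^ k := by ring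
      _ ≤ ε := by linarith
  -- (v) assemble
  have h := crnLag_replicas_burnIn_bernstein_abs_target_chiSq hw0 hmem h1 Khat hK x hM ν hν hf ha hc k N hZm hlaw hind hσ hσk
    hε.le hR
  refine le_trans (le_trans (measureReal_mono fun ω hω => ?_) h) (by linarith)
  simp only [Set.mem_setOf_eq] at hω ⊢
  linarith

end Replicas

end Summit.Ventures.LatticeQCDFlow.Exactness

end
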